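import Mathlib
import Summits.ValiantsHypothesis.ValiantsHypothesis.Theorems.GrenetZeonTwoDimCoefficientsDefs

/-!
# Crux `GrenetZeon.TwoDimCoefficients` (stmt-ValiantsHypothesis-8062), line `dim2_cases`, stub
# `stub_dualUnipotent`: the unipotent dual model CONTAINS trace-IMM (kernel-checked calibration)

The registered stub `stub_dualUnipotent : DualUnipotentBound` asks for `n² ≤ C·m` whenever
`per_n = α·det A + β·tr(adj A · B)` with `A, B` affine `m × m` over `ℂ[x_ij]` and `det A ≡ c ≠ 0`.
The calibration memo (`Cruxes/TwoDimCoefficients/CALIBRATION-stub_dualUnipotent.md`, v3) grades it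
OPEN-PROBLEM because the model contains trace-closed branching programs; this file makes that
containment a tree theorem.

**Theorem (`dualUnipotentRepr_of_traceIMM`).** If `per_n = tr(X_0 X_1 ⋯ X_d)` with affine `w × w`
blocks `X_i`, then `DualUnipotentRepr n ((d+1)·w)`.  Construction (the standard ABP → determinant
gadget, closed up into a trace): on the index set `Fin (d+1) × Fin w` let `S` be the block shift
with blocks `S_{(i,i+1)} = X_i` (`i < d`), `A = 1 − S`, and `B` the corner block `B_{(d,0)} = X_d`.
Then `S^{d+1} = 0` (`shift_pow`, `shift_pow_eq_zero`), `A⁻¹ = Σ_{i≤d} S^i` (`mul_neg_geom_sum`),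
`det A` is a unit of `ℂ[x]`, i.e. a non-zero constant (`MvPolynomial.isUnit_iff_eq_C_of_isReduced`),
`adj A = det A · A⁻¹`, and `tr(S^i · B) = [i = d]·tr(X_0 ⋯ X_{d-1} X_d)` (`trace_shift_pow_mul_corner`),
so `tr(adj A · B) = det A · tr(X_0 ⋯ X_d)` (`trace_adjugate_gadget`); reindex by
`finProdFinEquiv`.

**Corollary (`traceIMM_bound_of_dualUnipotentBound`).** `DualUnipotentBound` implies a LINEAR
trace-IMM width bound for the permanent: `per_n = tr(X_0 ⋯ X_d)` (affine `w × w` blocks, `n ≥ n₀`)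
forces `n² ≤ C·(d+1)·w`, i.e. width `≥ n/C` at `d + 1 = n` layers.  The bound in print for this
model is `w ≥ √(n/2)` (the trace of a width-`w` product is a sum of `w` branching programs, so
`dc ≤ (d+1)w² + 1`, then Mignon–Ressayre); a linear width bound would separate `per_n` from
trace-IMM_{√n, n} (same number of variables and degree), which no flattening / partial-derivative /
Hessian-at-a-point measure does.  So the stub is at least as hard as that open improvement — the
precise sense in which it is open-problem grade.  (The triangularisable case of the stub is NOT
easier: the shift pencil above is block strictly upper triangular.)

HONEST FRAMING: a calibration (the stub implies an open-looking classical bound), landed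
`--supports stmt-ValiantsHypothesis-8062 --as helper`; nothing here proves or refutes the stub, the
crux is an ASIDE item, and `VP ≠ VNP` is not moved.

References: L. G. Valiant, *Completeness classes in algebra*, STOC 1979 (branching programs as
determinants); N. Nisan, *Lower bounds for non-commutative computation*, STOC 1991 (IMM);
T. Mignon, N. Ressayre, Int. Math. Res. Not. 2004:79; J. M. Landsberg, *Geometry and Complexity
Theory* (2017), §6.4 and §7.3 (IMM, `dc`).
-/

set_option linter.dupNamespace false

noncomputable section

namespace Summit.ValiantsHypothesis.ValiantsHypothesis.Cruxes.TwoDimCoefficients.DimTwoCases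

open MvPolynomial Matrix
open Literature.Computability.AlgebraicComplexity

section Gadget

variable {R : Type*} [CommRing R] {d w : ℕ}

/-- A `List.ofFn` product is the corresponding `List.range` product. [folklore] -/
theorem prod_ofFn_eq_prod_range_map {M : Type*} [Monoid M] {k : ℕ} (f : Fin k → M) (Y : ℕ → M)
    (h : ∀ i : Fin k, f i = Y i.val) : (List.ofFn f).prod = ((List.range k).map Y).prod := by
  induction k with
  | zero => simp
  | succ k ih =>
      rw [List.ofFn_succ', List.concat_eq_append, List.prod_append, List.prod_singleton,
        List.range_succ, List.map_append, List.map_singleton, List.prod_append, List.prod_singleton,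
        ih (fun i => f (Fin.castSucc i)) (fun i => by rw [h]; rfl), h]
      rfl

/-- Powers of the block shift: `(S^j)` has block `(i, i+j)` equal to `Y_i Y_{i+1} ⋯ Y_{i+j-1}`.
[folklore] -/
theorem shift_pow (Y : ℕ → Matrix (Fin w) (Fin w) R) (j : ℕ) :
    (Matrix.of fun p q : Fin (d + 1) × Fin w =>
        if p.1.val + 1 = q.1.val then Y p.1.val p.2 q.2 else 0) ^ j =
      Matrix.of fun p q : Fin (d + 1) × Fin w =>
        if p.1.val + j = q.1.val then
          ((List.range j).map fun k => Y (p.1.val + k)).prod p.2 q.2 else 0 := by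
  classical
  induction j with
  | zero =>
      ext p q
      simp only [pow_zero, Matrix.of_apply, add_zero, List.range_zero, List.map_nil, List.prod_nil]
      rw [Matrix.one_apply, Matrix.one_apply]
      by_cases hpq : p = q
      · subst hpq; simp
      · rw [if_neg hpq]
        by_cases h1 : p.1.val = q.1.val
        · rw [if_pos h1, if_neg]
          intro h2
          exact hpq (Prod.ext (Fin.ext h1) h2)
        · rw [if_neg h1]
  | succ j ih =>
      rw [pow_succ, ih]
      ext p q
      rw [Matrix.mul_apply, Matrix.of_apply]
      by_cases h : p.1.val + (j + 1) = q.1.val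
      · rw [if_pos h]
        have hr : p.1.val + j < d + 1 := by have := q.1.isLt; omega
        set r₀ : Fin (d + 1) := ⟨p.1.val + j, hr⟩ with hr₀
        have hr₀v : r₀.val = p.1.val + j := rfl
        rw [Fintype.sum_prod_type, Finset.sum_eq_single r₀]
        · rw [List.range_succ, List.map_append, List.map_singleton, List.prod_append,
            List.prod_singleton, Matrix.mul_apply]
          refine Finset.sum_congr rfl fun r2 _ => ?_
          have h1 : p.1.val + j = (r₀, r2).1.val := hr₀v.symm
          have h2 : (r₀, r2).1.val + 1 = q.1.val := by rw [hr₀v]; omega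
          rw [Matrix.of_apply, Matrix.of_apply, if_pos h1, if_pos h2]
        · intro r1 _ hr1
          refine Finset.sum_eq_zero fun r2 _ => ?_
          have : ¬ (p.1.val + j = (r1, r2).1.val) := fun h' =>
            hr1 (Fin.ext (by rw [hr₀v]; exact h'.symm))
          rw [Matrix.of_apply, if_neg this, zero_mul]
        · intro h'; exact absurd (Finset.mem_univ _) h'
      · rw [if_neg h]
        refine Finset.sum_eq_zero fun r _ => ?_
        rw [Matrix.of_apply, Matrix.of_apply]
        by_cases h1 : p.1.val + j = r.1.val
        · by_cases h2 : r.1.val + 1 = q.1.val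
          · exact absurd (by omega) h
          · rw [if_neg h2, mul_zero]
        · rw [if_neg h1, zero_mul]

/-- The block shift is nilpotent of index `≤ d + 1`. [folklore] -/
theorem shift_pow_eq_zero (Y : ℕ → Matrix (Fin w) (Fin w) R) :
    (Matrix.of fun p q : Fin (d + 1) × Fin w =>
        if p.1.val + 1 = q.1.val then Y p.1.val p.2 q.2 else 0) ^ (d + 1) = 0 := by
  rw [shift_pow]
  ext p q
  simp only [Matrix.of_apply, Matrix.zero_apply]
  rw [if_neg]
  have := q.1.isLt
  omega

/-- `(1 − S) · Σ_{i ≤ d} S^i = 1` for the block shift `S`. [folklore] -/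
theorem one_sub_shift_mul_geom_sum (Y : ℕ → Matrix (Fin w) (Fin w) R) :
    (1 - Matrix.of fun p q : Fin (d + 1) × Fin w =>
        if p.1.val + 1 = q.1.val then Y p.1.val p.2 q.2 else 0) *
      (∑ i ∈ Finset.range (d + 1), (Matrix.of fun p q : Fin (d + 1) × Fin w =>
        if p.1.val + 1 = q.1.val then Y p.1.val p.2 q.2 else 0) ^ i) = 1 := by
  rw [mul_neg_geom_sum, shift_pow_eq_zero, sub_zero]

/-- Traces against the corner block: `tr(S^j · C(Z)) = [j = d] · tr(Y_0 ⋯ Y_{d-1} · Z)`. [folklore] -/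
theorem trace_shift_pow_mul_corner (Y : ℕ → Matrix (Fin w) (Fin w) R) (Z : Matrix (Fin w) (Fin w) R)
    (j : ℕ) :
    ((Matrix.of fun p q : Fin (d + 1) × Fin w =>
        if p.1.val + 1 = q.1.val then Y p.1.val p.2 q.2 else 0) ^ j *
      (Matrix.of fun p q : Fin (d + 1) × Fin w =>
        if p.1 = Fin.last d ∧ q.1 = 0 then Z p.2 q.2 else 0)).trace =
      if j = d then (((List.range d).map Y).prod * Z).trace else 0 := by
  classical
  rw [shift_pow, Matrix.trace]
  simp only [Matrix.diag_apply, Matrix.mul_apply, Matrix.of_apply]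
  rw [Fintype.sum_prod_type, Finset.sum_eq_single (0 : Fin (d + 1))]
  · by_cases hj : j = d
    · rw [if_pos hj, Matrix.trace]
      refine Finset.sum_congr rfl fun p2 _ => ?_
      rw [Matrix.diag_apply, Matrix.mul_apply, Fintype.sum_prod_type,
        Finset.sum_eq_single (Fin.last d)]
      · refine Finset.sum_congr rfl fun r2 _ => ?_
        have h1 : ((0 : Fin (d + 1)), p2).1.val + j = (Fin.last d, r2).1.val := by simp [hj]
        have h2 : (Fin.last d, r2).1 = Fin.last d ∧ ((0 : Fin (d + 1)), p2).1 = 0 := ⟨rfl, rfl⟩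
        rw [if_pos h1, if_pos h2, hj]
        have h0 : (fun k => Y (((0 : Fin (d + 1)), p2).1.val + k)) = Y := by
          funext k; simp
        rw [h0]
      · intro r1 _ hr1
        refine Finset.sum_eq_zero fun r2 _ => ?_
        have : ¬ ((r1, r2).1 = Fin.last d ∧ ((0 : Fin (d + 1)), p2).1 = 0) := fun h => hr1 h.1
        rw [if_neg this, mul_zero]
      · intro h'; exact absurd (Finset.mem_univ _) h'
    · rw [if_neg hj]
      refine Finset.sum_eq_zero fun p2 _ => Finset.sum_eq_zero fun r _ => ?_
      by_cases h1 : ((0 : Fin (d + 1)), p2).1.val + j = r.1.val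
      · have : ¬ (r.1 = Fin.last d ∧ ((0 : Fin (d + 1)), p2).1 = 0) := by
          rintro ⟨h2, -⟩
          apply hj
          rw [h2, Fin.val_last] at h1
          simpa using h1
        rw [if_neg this, mul_zero]
      · rw [if_neg h1, zero_mul]
  · intro p1 _ hp1
    refine Finset.sum_eq_zero fun p2 _ => Finset.sum_eq_zero fun r _ => ?_
    have : ¬ (r.1 = Fin.last d ∧ (p1, p2).1 = 0) := fun h => hp1 h.2
    rw [if_neg this, mul_zero]
  · intro h'; exact absurd (Finset.mem_univ _) h'

/-- **The gadget.** With `A = 1 − S` (block shift by `Y_0, …, Y_{d-1}`) and `B = C(Z)` (corner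
block `Z`): `det A` is a unit and `tr(adj A · B) = det A · tr(Y_0 ⋯ Y_{d-1} · Z)`. [folklore] -/
theorem trace_adjugate_gadget (Y : ℕ → Matrix (Fin w) (Fin w) R) (Z : Matrix (Fin w) (Fin w) R) :
    IsUnit (1 - Matrix.of fun p q : Fin (d + 1) × Fin w =>
        if p.1.val + 1 = q.1.val then Y p.1.val p.2 q.2 else 0).det ∧
    ((1 - Matrix.of fun p q : Fin (d + 1) × Fin w =>
        if p.1.val + 1 = q.1.val then Y p.1.val p.2 q.2 else 0).adjugate *
      (Matrix.of fun p q : Fin (d + 1) × Fin w =>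
        if p.1 = Fin.last d ∧ q.1 = 0 then Z p.2 q.2 else 0)).trace =
      (1 - Matrix.of fun p q : Fin (d + 1) × Fin w =>
        if p.1.val + 1 = q.1.val then Y p.1.val p.2 q.2 else 0).det *
        (((List.range d).map Y).prod * Z).trace := by
  classical
  set S : Matrix (Fin (d + 1) × Fin w) (Fin (d + 1) × Fin w) R :=
    Matrix.of fun p q => if p.1.val + 1 = q.1.val then Y p.1.val p.2 q.2 else 0 with hS
  set Cz : Matrix (Fin (d + 1) × Fin w) (Fin (d + 1) × Fin w) R :=
    Matrix.of fun p q => if p.1 = Fin.last d ∧ q.1 = 0 then Z p.2 q.2 else 0 with hCz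
  have hgeom : (1 - S) * (∑ i ∈ Finset.range (d + 1), S ^ i) = 1 := by
    rw [hS]; exact one_sub_shift_mul_geom_sum Y
  have hunit : IsUnit (1 - S).det := Matrix.isUnit_det_of_right_inverse hgeom
  refine ⟨hunit, ?_⟩
  have hinv : (1 - S)⁻¹ = ∑ i ∈ Finset.range (d + 1), S ^ i := Matrix.inv_eq_right_inv hgeom
  have hadj : (1 - S).adjugate = (1 - S).det • (1 - S)⁻¹ := by
    rw [Matrix.inv_def, smul_smul, Ring.mul_inverse_cancel _ hunit, one_smul]
  rw [hadj, hinv, Matrix.smul_mul, Matrix.trace_smul, Finset.sum_mul, Matrix.trace_sum, smul_eq_mul]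
  congr 1
  have hterm : ∀ i, (S ^ i * Cz).trace = if i = d then (((List.range d).map Y).prod * Z).trace else 0 :=
    fun i => by rw [hS, hCz]; exact trace_shift_pow_mul_corner Y Z i
  simp_rw [hterm]
  rw [Finset.sum_ite_eq' (Finset.range (d + 1)) d, if_pos (Finset.self_mem_range_succ d)]

end Gadget

/-! ### Trace-IMM representations are unipotent dual representations -/

section TraceIMM

variable {n d w : ℕ}

/-- **Trace-IMM embeds into the unipotent dual model.** If `per_n = tr(X_0 X_1 ⋯ X_d)` with
`X_i` affine `w × w` matrices over `ℂ[x]`, then `DualUnipotentRepr n ((d+1)·w)`: take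
`A = 1 − S` the block shift by `X_0, …, X_{d-1}` (block unipotent, `det A` a non-zero constant) and
`B` the corner block `X_d`; then `tr(adj A · B) = det A · tr(X_0 ⋯ X_d)`. [folklore] -/
theorem dualUnipotentRepr_of_traceIMM
    (X : Fin (d + 1) → Matrix (Fin w) (Fin w) (MvPolynomial (Fin n × Fin n) ℂ))
    (hX : ∀ i a b, (X i a b).totalDegree ≤ 1)
    (hper : perPoly (Fin n) ℂ = ((List.ofFn X).prod).trace) :
    DualUnipotentRepr n ((d + 1) * w) := by
  classical
  -- blocks indexed by naturals (junk `1` beyond `d`)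
  let Y : ℕ → Matrix (Fin w) (Fin w) (MvPolynomial (Fin n × Fin n) ℂ) :=
    fun k => if h : k < d + 1 then X ⟨k, h⟩ else 1
  have hY : ∀ i : Fin (d + 1), X i = Y i.val := fun i => by
    simp only [Y, dif_pos i.isLt]
  set S : Matrix (Fin (d + 1) × Fin w) (Fin (d + 1) × Fin w) (MvPolynomial (Fin n × Fin n) ℂ) :=
    Matrix.of fun p q => if p.1.val + 1 = q.1.val then Y p.1.val p.2 q.2 else 0 with hS
  set Cz : Matrix (Fin (d + 1) × Fin w) (Fin (d + 1) × Fin w) (MvPolynomial (Fin n × Fin n) ℂ) :=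
    Matrix.of fun p q => if p.1 = Fin.last d ∧ q.1 = 0 then X (Fin.last d) p.2 q.2 else 0 with hCz
  obtain ⟨hunit, htr⟩ := trace_adjugate_gadget (d := d) Y (X (Fin.last d))
  rw [← hCz] at htr
  -- the product `X_0 ⋯ X_d`
  have hprod : (List.ofFn X).prod = ((List.range d).map Y).prod * X (Fin.last d) := by
    rw [prod_ofFn_eq_prod_range_map X Y hY, List.range_succ, List.map_append, List.map_singleton,
      List.prod_append, List.prod_singleton, hY (Fin.last d), Fin.val_last]
  -- `det (1 - S) = C c`, `c ≠ 0`
  obtain ⟨c, hc, hdetc⟩ := MvPolynomial.isUnit_iff_eq_C_of_isReduced.mp hunit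
  -- reindex to `Fin ((d+1) w)`
  let e : Fin (d + 1) × Fin w ≃ Fin ((d + 1) * w) := finProdFinEquiv
  refine ⟨0, c⁻¹, c, Matrix.reindex e e (1 - S), Matrix.reindex e e Cz, ?_, ?_, hc.ne_zero, ?_, ?_⟩
  · -- `A` affine
    intro i j
    rw [Matrix.reindex_apply, Matrix.submatrix_apply, Matrix.sub_apply, Matrix.one_apply, hS,
      Matrix.of_apply]
    refine (totalDegree_sub _ _).trans (max_le ?_ ?_)
    · split_ifs
      · rw [totalDegree_one]; exact Nat.zero_le _
      · rw [totalDegree_zero]; exact Nat.zero_le _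
    · split_ifs
      · rw [← hY ⟨(e.symm i).1.val, (e.symm i).1.isLt⟩]
        exact hX _ _ _
      · rw [totalDegree_zero]; exact Nat.zero_le _
  · -- `B` affine
    intro i j
    rw [Matrix.reindex_apply, Matrix.submatrix_apply, hCz, Matrix.of_apply]
    split_ifs
    · exact hX _ _ _
    · rw [totalDegree_zero]; exact Nat.zero_le _
  · rw [Matrix.det_reindex_self, hdetc]
  · rw [Matrix.det_reindex_self, Matrix.adjugate_reindex, Matrix.reindex_apply, Matrix.reindex_apply,
      Matrix.submatrix_mul_equiv, map_zero, zero_mul, zero_add]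
    have htr' : (((1 - S).adjugate * Cz).submatrix e.symm e.symm).trace = ((1 - S).adjugate * Cz).trace :=
      Fintype.sum_equiv e.symm _ _ fun _ => rfl
    rw [htr', htr, hdetc, hper, hprod, ← mul_assoc, ← map_mul, inv_mul_cancel₀ hc.ne_zero, map_one,
      one_mul]

/-- **Lower calibration of the stub (kernel-checked): `DualUnipotentBound` implies a LINEAR
trace-IMM width bound for the permanent.**  If `DualUnipotentBound` holds then there are `C, n₀`
with: whenever `per_n = tr(X_0 ⋯ X_d)` with affine `w × w` blocks (`n ≥ n₀`), `n² ≤ C·(d+1)·w`;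
in particular for `d + 1 = n` layers the width is `≥ n/C`.  The best bound in print for this
model is `w ≥ √(n/2)` (`dc ≤ (d+1)w² + 1` and Mignon–Ressayre), so the registered stub is at least
as hard as a quadratic improvement of the trace-IMM width lower bound for the permanent. [folklore] -/
theorem traceIMM_bound_of_dualUnipotentBound (h : DualUnipotentBound) :
    ∃ C n₀ : ℕ, ∀ n ≥ n₀, ∀ d w : ℕ,
      ∀ X : Fin (d + 1) → Matrix (Fin w) (Fin w) (MvPolynomial (Fin n × Fin n) ℂ),
        (∀ i a b, (X i a b).totalDegree ≤ 1) →
        perPoly (Fin n) ℂ = ((List.ofFn X).prod).trace → n ^ 2 ≤ C * ((d + 1) * w) := by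
  obtain ⟨C, n₀, hC⟩ := h
  exact ⟨C, n₀, fun n hn d w X hX hper => hC n hn _ (dualUnipotentRepr_of_traceIMM X hX hper)⟩

end TraceIMM

end Summit.ValiantsHypothesis.ValiantsHypothesis.Cruxes.TwoDimCoefficients.DimTwoCases

end
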